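import Literature.MathematicalPhysics.QuantumLattice.HubbardTorusFluxBlochBound
import Literature.MathematicalPhysics.QuantumLattice.MagneticHubbardTorusGauge
import Literature.MathematicalPhysics.QuantumLattice.ApproximatingHamiltonianProofs
import Literature.MathematicalPhysics.QuantumLattice.ApproximateEigenvectorLemmas
import Literature.MathematicalPhysics.QuantumLattice.StabilityReductionProofs
import HarnessLib

/-!
# The thermal Bloch bound for the flux-threaded Hubbard torus, on every coordinate sector

Topic `Literature/MathematicalPhysics/QuantumLattice` (family `hubbard`); positive-temperature
companion of `HubbardTorusFluxBlochBound.lean` (`fluxEnergy_le_fluxEnergy_zero_add_two_mul_sq`: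
`E^T_L(θ) ≤ E^T_L(0) + 2θ²`). Consumer: route `LogColdTorus` of `Summits/HubbardSuperconductivity`
(crux `LogColdDWaveOrder`, whose stiffness stub prices the seam flux in the `(N_L, S^z = 0)`-sector
partition functions at `β_L = κ log L`; the ceiling `ρ ≤ 2` on that stub is read off in the
summit-side file `Theorems/LogColdTorusLogColdDWaveOrderStiffnessCeiling.lean`). Everything here is
PROVED; no definition, no named fact.

Main result `exp_mul_re_partitionFn_toBlock_hubbardTorus_le` — **thermal Bloch bound, every
coordinate sector**: for `L ≥ 3`, `β ≥ 0`, every `U, θ` and EVERY predicate `p` on occupation sets,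
`e^{-2βθ²} · Re Z_β((hubbardTorus 2 L 1 U)|_p) ≤ Re Z_β((hubbardTorusFlux L U θ)|_p)`
(`Matrix.partitionFn` of the `Matrix.toBlock p p` compressions), i.e. threading the flux `θ` through
the torus costs sector free energy at most `2θ²`: `F_p(θ) - F_p(0) ≤ 2θ²`, uniformly in `L`, `U`,
`β` and `p`. Proof:
* gauge the seam flux into the uniform twist `e^{± iθ/L}` (`partitionFn_toBlock_uniformTwist_eq`:
  the Lieb–Schultz–Mattis twist `phaseGauge (twistGauge L θ ∘ toTorusSite)` is DIAGONAL in the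
  occupation basis, so it commutes with every compression `Matrix.toBlock p p` and leaves `Z`
  invariant);
* Peierls–Bogoliubov twice at the midpoint `B = ½(H_θ + H_{-θ})|_p`
  (`log_partitionFn_sub_le_log_partitionFn_add`) gives `log Z(H_θ|_p) + log Z(H_{-θ}|_p) ≥ 2 log Z(B)`
  — the two first-order terms cancel exactly, no expectation has to be estimated;
* time reversal = entrywise complex conjugation reverses the flux (`hubbardTorusFlux_map_conj`),
  commutes with the compression and conjugates `Z` (`partitionFn_map_starRingEnd`), so
  `Re Z(H_{-θ}|_p) = Re Z(H_θ|_p)` (`re_partitionFn_toBlock_hubbardTorusFlux_neg`);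
* `B ≤ H|_p + 2θ²` as quadratic forms (`posSemidef_sub_half_twist_add_twist_neg`, compressed by
  `Matrix.PosSemidef.submatrix`): in `Re⟨φ, (H_θ + H_{-θ}) φ⟩` the bond currents cancel and the
  kinetic weights pay `4(1 - cos(θ/L)) K(φ)`, `|K(φ)| ≤ 2L² ‖φ‖²`, `1 - cos(θ/L) ≤ θ²/(2L²)`;
  the monotonicity of the free energy (`log_partitionFn_le_of_posSemidef`) and the scalar shift
  (`log_partitionFn_add_smul_one`) finish.
* Degenerate (empty) sector: both partition functions vanish.

Not here: the sides `L = 1, 2` (the uniform-twist gauge needs `L ≥ 3`; the seam-gauge argument of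
the zero-temperature file would give them, but no consumer needs them).

## References

* D. Bohm, Phys. Rev. 75 (1949) 502 (Bloch's theorem on persistent currents, free-energy form). [Bohm1949]
* H. Watanabe, J. Stat. Phys. 177 (2019) 717, §2.2.1 eqs. (13)–(16), §2.2.3, §4.1. [Watanabe2019]
* N. Byers, C. N. Yang, PRL 7 (1961) 46 (evenness of the free energy in the flux). [ByersYang1961]
* D. J. Scalapino, S. R. White, S. Zhang, PRB 47 (1993) 7995 (`D_s` from the flux dependence of the
  free energy). [ScalapinoWhiteZhang1993]
-/

noncomputable section

namespace Literature.MathematicalPhysics.QuantumLattice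

open Matrix Finset Literature.MathematicalPhysics.QuantumFieldTheory
open scoped ComplexConjugate ComplexOrder Matrix.Norms.L2Operator

/-! ### Matrix facts: entrywise conjugation, diagonal unitaries, blocks -/

section MatrixFacts

variable {n : Type*} [Fintype n] [DecidableEq n]

omit [Fintype n] [DecidableEq n] in
/-- Entrywise complex conjugation is `transpose ∘ conjTranspose`. [folklore] -/
theorem map_starRingEnd_eq_conjTranspose_transpose (M : Matrix n n ℂ) :
    M.map (starRingEnd ℂ) = Mᴴᵀ := by
  ext i j
  simp only [map_apply, transpose_apply, conjTranspose_apply, Complex.star_def]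

/-- The matrix exponential commutes with entrywise complex conjugation. [folklore] -/
theorem exp_map_starRingEnd (M : Matrix n n ℂ) :
    NormedSpace.exp (M.map (starRingEnd ℂ)) = (NormedSpace.exp M).map (starRingEnd ℂ) := by
  rw [map_starRingEnd_eq_conjTranspose_transpose, Matrix.exp_transpose, Matrix.exp_conjTranspose,
    map_starRingEnd_eq_conjTranspose_transpose]

/-- The Gibbs weight of the conjugated matrix is the conjugated Gibbs weight (`β` real). [folklore] -/
theorem gibbsWeight_map_starRingEnd (β : ℝ) (M : Matrix n n ℂ) :
    gibbsWeight β (M.map (starRingEnd ℂ)) = (gibbsWeight β M).map (starRingEnd ℂ) := by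
  have h : (-(β : ℂ) • M).map (starRingEnd ℂ) = -(β : ℂ) • M.map (starRingEnd ℂ) := by
    ext i j
    simp [Matrix.map_apply, Complex.conj_ofReal]
  rw [gibbsWeight, gibbsWeight, ← h, exp_map_starRingEnd]

/-- **Time reversal of the partition function**: `Z_β(conj M) = conj Z_β(M)`. [folklore] -/
theorem partitionFn_map_starRingEnd (β : ℝ) (M : Matrix n n ℂ) :
    partitionFn β (M.map (starRingEnd ℂ)) = starRingEnd ℂ (partitionFn β M) := by
  rw [partitionFn, partitionFn, gibbsWeight_map_starRingEnd]
  simp [Matrix.trace, map_sum]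

/-- Unitary invariance of `Z` under a diagonal unitary `diag(v)`, `|v a| = 1`. [folklore] -/
theorem partitionFn_diagonal_star_mul_mul_diagonal (v : n → ℂ) (hv : ∀ a, star (v a) * v a = 1)
    (β : ℝ) (H : Matrix n n ℂ) :
    partitionFn β (diagonal (fun a => star (v a)) * H * diagonal v) = partitionFn β H := by
  have hv' : ∀ a, v a * star (v a) = 1 := fun a => by rw [mul_comm]; exact hv a
  have hsv : (fun a => star (v a)) = star v := rfl
  rw [hsv]
  have hU : diagonal (star v) ∈ unitary (Matrix n n ℂ) := by
    rw [Unitary.mem_iff, star_eq_conjTranspose, diagonal_conjTranspose, star_star,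
      diagonal_mul_diagonal, diagonal_mul_diagonal]
    constructor
    · rw [← diagonal_one]
      congr 1
      funext a
      exact hv' a
    · rw [← diagonal_one]
      congr 1
      funext a
      exact hv a
  have h := partitionFn_unitary_conj hU β H
  rwa [star_eq_conjTranspose, diagonal_conjTranspose, star_star] at h

omit [Fintype n] [DecidableEq n] in
/-- Compression commutes with entrywise maps. [folklore] -/
theorem toBlock_map (M : Matrix n n ℂ) (p : n → Prop) (f : ℂ → ℂ) :
    (M.map f).toBlock p p = (M.toBlock p p).map f := rfl

omit [Fintype n] [DecidableEq n] in
/-- `(diag v)ᴴ = diag(conj v)`, for WHATEVER decidability instance built the diagonal (the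
occupation-basis diagonals of the tree come with the `LinearOrder`-derived instance). [folklore] -/
theorem conjTranspose_diagonal_inst {inst : DecidableEq n} (v : n → ℂ) :
    (@diagonal n ℂ inst _ v)ᴴ = @diagonal n ℂ inst _ (fun a => star (v a)) := by
  ext i j
  simp only [conjTranspose_apply, diagonal, of_apply]
  by_cases h : i = j
  · subst h
    simp
  · rw [if_neg (Ne.symm h), if_neg h, star_zero]

omit [DecidableEq n] in
/-- Compressing `diag(d) · M · diag(e)` compresses `M` and restricts the diagonals (again for any
decidability instance on `n`). [folklore] -/
theorem toBlock_diagonal_mul_mul_diagonal {inst : DecidableEq n} (d e : n → ℂ) (M : Matrix n n ℂ)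
    (p : n → Prop) [Fintype {a // p a}] [DecidableEq {a // p a}] :
    (@diagonal n ℂ inst _ d * M * @diagonal n ℂ inst _ e).toBlock p p =
      diagonal (fun a : {a // p a} => d a) * M.toBlock p p * diagonal (fun a : {a // p a} => e a) := by
  ext a b
  simp only [toBlock_apply, mul_diagonal, diagonal_mul]

end MatrixFacts

/-! ### A hopping amplitude is bounded by the norm squared -/

section Hops

variable {Λ : Type*} [LinearOrder Λ] [Fintype Λ]

/-- `|Re⟨φ, c†_p c_q φ⟩| ≤ ‖φ‖²` for every Fock vector `φ` (`‖c†_p‖, ‖c_q‖ ≤ 1`). [folklore] -/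
theorem abs_re_hop_le_re_star_dotProduct_self (φ : Fock Λ) (p q : Λ) :
    |(star φ ⬝ᵥ ((creation p * annihilation q) *ᵥ φ)).re| ≤ (star φ ⬝ᵥ φ).re := by
  refine (Complex.abs_re_le_norm _).trans ?_
  refine (norm_star_dotProduct_le _ _).trans ?_
  rw [← eucNorm_sq, sq]
  refine mul_le_mul_of_nonneg_left ?_ (eucNorm_nonneg _)
  refine (eucNorm_mulVec_le _ _).trans ?_
  refine mul_le_of_le_one_left (eucNorm_nonneg _) ?_
  exact (l2_opNorm_mul _ _).trans
    (mul_le_one₀ (norm_creation_le_one _) (norm_nonneg _) (norm_annihilation_le_one _))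

end Hops

/-! ### The averaged twist is dominated by `H + 2θ²` -/

section Twist

variable {L : ℕ} [NeZero L]

/-- The `e₁`-kinetic weight of ANY Fock vector is at most `2L²` times its norm squared:
`|Σ_{x,σ} Re⟨φ, c†_{x+e₁,σ} c_{x,σ} φ⟩| ≤ 2L² Re⟨φ, φ⟩`. [folklore] -/
theorem abs_sum_re_hop_le_mul_re_star_dotProduct_self (φ : Fock (Orb (FermionTorus 2 L))) :
    |∑ x : Site 2 L, ∑ σ : Fin 2,
        (star φ ⬝ᵥ ((creation (orb (FermionTorus.ofTorusSite (Site.shift x 0)) σ) *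
          annihilation (orb (FermionTorus.ofTorusSite x) σ)) *ᵥ φ)).re| ≤
      2 * (L : ℝ) ^ 2 * (star φ ⬝ᵥ φ).re := by
  refine (Finset.abs_sum_le_sum_abs _ _).trans ?_
  have h : ∀ x ∈ (Finset.univ : Finset (Site 2 L)), |∑ σ : Fin 2,
      (star φ ⬝ᵥ ((creation (orb (FermionTorus.ofTorusSite (Site.shift x 0)) σ) *
        annihilation (orb (FermionTorus.ofTorusSite x) σ)) *ᵥ φ)).re| ≤
        2 * (star φ ⬝ᵥ φ).re := fun x _ => by
    refine (Finset.abs_sum_le_sum_abs _ _).trans ?_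
    refine (Finset.sum_le_sum fun σ _ => abs_re_hop_le_re_star_dotProduct_self φ _ _).trans ?_
    simp [two_mul]
  refine (Finset.sum_le_sum h).trans ?_
  rw [Finset.sum_const, Finset.card_univ, nsmul_eq_mul]
  have hcard : (Fintype.card (Site 2 L) : ℝ) = (L : ℝ) ^ 2 := by
    rw [Fintype.card_fun, ZMod.card, Fintype.card_fin]; push_cast; ring
  rw [hcard]
  ring_nf
  rfl

/-- **The averaged twist is dominated by `H + 2θ²`** (operator form of Bloch's estimate): with
`H_{±θ}` the torus uniformly twisted by `e^{± iθ/L}` on the `e₁`-bonds and `H = H_1` the untwisted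
Peierls torus, `H + 2θ² - ½(H_θ + H_{-θ}) ≥ 0` — in expectation the bond currents cancel between
`± θ` and the kinetic weights pay `2(1 - cos(θ/L)) K(φ) ≤ (θ/L)² · 2L² ‖φ‖²`.
Watanabe (2019) §2.2.1, eqs. (13)–(16). [folklore] -/
theorem posSemidef_sub_half_twist_add_twist_neg (θ U : ℝ) :
    (magneticHubbardTorus L 1 1 U + ((2 * θ ^ 2 : ℝ) : ℂ) •
        (1 : Matrix (Finset (Orb (FermionTorus 2 L))) (Finset (Orb (FermionTorus 2 L))) ℂ) -
      ((1 / 2 : ℝ) : ℂ) • (magneticHubbardTorus L (uniformTwistConfig L θ) 1 U +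
        magneticHubbardTorus L (uniformTwistConfig L (-θ)) 1 U)).PosSemidef := by
  have hH1 : (magneticHubbardTorus L 1 1 U).IsHermitian := magneticHubbardTorus_isHermitian _ _ _
  have hHp : (magneticHubbardTorus L (uniformTwistConfig L θ) 1 U).IsHermitian :=
    magneticHubbardTorus_isHermitian _ _ _
  have hHm : (magneticHubbardTorus L (uniformTwistConfig L (-θ)) 1 U).IsHermitian :=
    magneticHubbardTorus_isHermitian _ _ _
  have hE : (magneticHubbardTorus L 1 1 U + ((2 * θ ^ 2 : ℝ) : ℂ) •
        (1 : Matrix (Finset (Orb (FermionTorus 2 L))) (Finset (Orb (FermionTorus 2 L))) ℂ) -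
      ((1 / 2 : ℝ) : ℂ) • (magneticHubbardTorus L (uniformTwistConfig L θ) 1 U +
        magneticHubbardTorus L (uniformTwistConfig L (-θ)) 1 U)).IsHermitian :=
    (hH1.add (isHermitian_ofReal_smul isHermitian_one _)).sub
      (isHermitian_ofReal_smul (hHp.add hHm) _)
  refine PosSemidef.of_dotProduct_mulVec_nonneg hE fun φ => ?_
  have him : (star φ ⬝ᵥ ((magneticHubbardTorus L 1 1 U + ((2 * θ ^ 2 : ℝ) : ℂ) •
        (1 : Matrix (Finset (Orb (FermionTorus 2 L))) (Finset (Orb (FermionTorus 2 L))) ℂ) -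
      ((1 / 2 : ℝ) : ℂ) • (magneticHubbardTorus L (uniformTwistConfig L θ) 1 U +
        magneticHubbardTorus L (uniformTwistConfig L (-θ)) 1 U)) *ᵥ φ)).im = 0 := by
    have h := hE.im_star_dotProduct_mulVec_self φ
    simpa using h
  -- the real part
  set K : ℝ := ∑ x : Site 2 L, ∑ σ : Fin 2,
    (star φ ⬝ᵥ ((creation (orb (FermionTorus.ofTorusSite (Site.shift x 0)) σ) *
      annihilation (orb (FermionTorus.ofTorusSite x) σ)) *ᵥ φ)).re with hK
  set J : ℝ := ∑ x : Site 2 L, ∑ σ : Fin 2,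
    (star φ ⬝ᵥ ((creation (orb (FermionTorus.ofTorusSite (Site.shift x 0)) σ) *
      annihilation (orb (FermionTorus.ofTorusSite x) σ)) *ᵥ φ)).im with hJ
  set N : ℝ := (star φ ⬝ᵥ φ).re with hN
  have hp := re_star_dotProduct_magneticHubbardTorus_uniformTwistConfig_mulVec θ U φ
  have hm := re_star_dotProduct_magneticHubbardTorus_uniformTwistConfig_mulVec (-θ) U φ
  rw [neg_div, Real.cos_neg, Real.sin_neg] at hm
  have hre : (star φ ⬝ᵥ ((magneticHubbardTorus L 1 1 U + ((2 * θ ^ 2 : ℝ) : ℂ) •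
        (1 : Matrix (Finset (Orb (FermionTorus 2 L))) (Finset (Orb (FermionTorus 2 L))) ℂ) -
      ((1 / 2 : ℝ) : ℂ) • (magneticHubbardTorus L (uniformTwistConfig L θ) 1 U +
        magneticHubbardTorus L (uniformTwistConfig L (-θ)) 1 U)) *ᵥ φ)).re =
      2 * θ ^ 2 * N - 2 * (1 - Real.cos (θ / L)) * K := by
    rw [sub_mulVec, add_mulVec, smul_mulVec, smul_mulVec, add_mulVec, one_mulVec,
      dotProduct_sub, dotProduct_add, dotProduct_smul, dotProduct_smul, dotProduct_add,
      Complex.sub_re, Complex.add_re, smul_eq_mul, smul_eq_mul, Complex.re_ofReal_mul,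
      Complex.re_ofReal_mul, Complex.add_re, hp, hm]
    ring
  -- Bloch's estimate `2(1 - cos(θ/L)) K ≤ 2θ² N`
  have hL0 : (0 : ℝ) < L := Nat.cast_pos.2 (NeZero.pos L)
  have hN0 : 0 ≤ N := by
    rw [hN, ← eucNorm_sq]; positivity
  have hKle : |K| ≤ 2 * (L : ℝ) ^ 2 * N := abs_sum_re_hop_le_mul_re_star_dotProduct_self φ
  have hc : 0 ≤ 1 - Real.cos (θ / L) := sub_nonneg.2 (Real.cos_le_one _)
  have hstep : 2 * (1 - Real.cos (θ / L)) * K ≤ 2 * θ ^ 2 * N :=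
    calc 2 * (1 - Real.cos (θ / L)) * K ≤ 2 * (1 - Real.cos (θ / L)) * |K| := by
          have := le_abs_self K; nlinarith
      _ ≤ (θ / L) ^ 2 * |K| := two_mul_one_sub_cos_mul_le _ _ (abs_nonneg K)
      _ ≤ (θ / L) ^ 2 * (2 * (L : ℝ) ^ 2 * N) := by gcongr
      _ = 2 * θ ^ 2 * N := by field_simp
  rw [Complex.nonneg_iff, hre, him]
  exact ⟨by linarith, rfl⟩

end Twist

/-! ### The thermal Bloch bound on every coordinate sector -/

section Thermal

variable {L : ℕ} [NeZero L]

/-- **Gauge invariance of the sector partition functions** (`L ≥ 3`): the uniformly twisted torus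
and the seam-flux torus `hubbardTorusFlux L U θ` have the same partition function on every
coordinate sector `p` (the Lieb–Schultz–Mattis twist is a diagonal unitary in the occupation basis,
so it commutes with the compression). Watanabe (2019) §2.2.3. [folklore] -/
theorem partitionFn_toBlock_uniformTwist_eq (hL : 3 ≤ L) (U θ β : ℝ)
    (p : Finset (Orb (FermionTorus 2 L)) → Prop) [Fintype {a // p a}] [DecidableEq {a // p a}] :
    partitionFn β ((magneticHubbardTorus L (uniformTwistConfig L θ) 1 U).toBlock p p) =
      partitionFn β ((hubbardTorusFlux L U θ).toBlock p p) := by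
  have hunit : ∀ z : Circle, star (z : ℂ) * (z : ℂ) = 1 := fun z => by
    rw [Complex.star_def, ← Complex.normSq_eq_conj_mul_self, Circle.normSq_coe, Complex.ofReal_one]
  rw [magneticHubbardTorus_uniformTwistConfig_eq_conj_hubbardTorusFlux hL U θ, phaseGauge_eq,
    conjTranspose_diagonal_inst, toBlock_diagonal_mul_mul_diagonal]
  exact partitionFn_diagonal_star_mul_mul_diagonal _ (fun a => hunit _) β _

/-- **Time reversal on a sector**: `Re Z_β((hubbardTorusFlux L U (-θ))|_p) = Re Z_β((hubbardTorusFlux L U θ)|_p)`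
(entrywise conjugation reverses the flux, `hubbardTorusFlux_map_conj`, commutes with the
compression and conjugates `Z`). Byers–Yang (1961). [folklore] -/
theorem re_partitionFn_toBlock_hubbardTorusFlux_neg (U θ β : ℝ)
    (p : Finset (Orb (FermionTorus 2 L)) → Prop) [Fintype {a // p a}] [DecidableEq {a // p a}] :
    (partitionFn β ((hubbardTorusFlux L U (-θ)).toBlock p p)).re =
      (partitionFn β ((hubbardTorusFlux L U θ).toBlock p p)).re := by
  rw [← hubbardTorusFlux_map_conj, toBlock_map, partitionFn_map_starRingEnd, Complex.conj_re]

/-- **Thermal Bloch bound on every coordinate sector** (`L ≥ 3`, `β ≥ 0`): for every predicate `p`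
on occupation sets, `e^{-2βθ²} Re Z_β((hubbardTorus 2 L 1 U)|_p) ≤ Re Z_β((hubbardTorusFlux L U θ)|_p)`,
i.e. the sector free energy of the flux-threaded torus exceeds the untwisted one by at most `2θ²`
— the positive-temperature form of Bloch's theorem / of `fluxEnergy_le_fluxEnergy_zero_add_two_mul_sq`.
Bohm (1949); Watanabe (2019) §2.2, §4.1 (the twist costs `O(L_y/L_x) = O(1)` in two dimensions).
[folklore] -/
theorem exp_mul_re_partitionFn_toBlock_hubbardTorus_le (hL : 3 ≤ L) (U θ : ℝ) {β : ℝ} (hβ : 0 ≤ β)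
    (p : Finset (Orb (FermionTorus 2 L)) → Prop) [Fintype {a // p a}] [DecidableEq {a // p a}] :
    Real.exp (-(2 * β * θ ^ 2)) * (partitionFn β ((hubbardTorus 2 L 1 U).toBlock p p)).re ≤
      (partitionFn β ((hubbardTorusFlux L U θ).toBlock p p)).re := by
  rcases isEmpty_or_nonempty {a // p a} with hp | hp
  · simp [partitionFn, Matrix.trace]
  set H1 := magneticHubbardTorus L 1 1 U with hH1def
  set Hp := magneticHubbardTorus L (uniformTwistConfig L θ) 1 U with hHpdef
  set Hm := magneticHubbardTorus L (uniformTwistConfig L (-θ)) 1 U with hHmdef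
  have h1 : hubbardTorus 2 L 1 U = H1 := (magneticHubbardTorus_one_eq_hubbardTorus hL 1 U).symm
  have hH1 : H1.IsHermitian := magneticHubbardTorus_isHermitian _ _ _
  have hHp : Hp.IsHermitian := magneticHubbardTorus_isHermitian _ _ _
  have hHm : Hm.IsHermitian := magneticHubbardTorus_isHermitian _ _ _
  -- midpoint and half-difference of the two twisted blocks
  set B : Matrix {a // p a} {a // p a} ℂ :=
    ((1 / 2 : ℝ) : ℂ) • (Hp.toBlock p p + Hm.toBlock p p) with hB
  set W : Matrix {a // p a} {a // p a} ℂ :=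
    ((1 / 2 : ℝ) : ℂ) • (Hp.toBlock p p - Hm.toBlock p p) with hW
  have hBh : B.IsHermitian := isHermitian_ofReal_smul ((hHp.submatrix _).add (hHm.submatrix _)) _
  have hWh : W.IsHermitian := isHermitian_ofReal_smul ((hHp.submatrix _).sub (hHm.submatrix _)) _
  have hBW : B + W = Hp.toBlock p p := by
    ext a b
    simp only [hB, hW, Matrix.add_apply, Matrix.smul_apply, Matrix.sub_apply, smul_eq_mul]
    push_cast
    ring
  have hBW' : B + -W = Hm.toBlock p p := by
    ext a b
    simp only [hB, hW, Matrix.add_apply, Matrix.neg_apply, Matrix.smul_apply, Matrix.sub_apply, smul_eq_mul]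
    push_cast
    ring
  -- Peierls–Bogoliubov twice at the midpoint
  have hPB1 := log_partitionFn_sub_le_log_partitionFn_add hBh hWh β
  have hPB2 := log_partitionFn_sub_le_log_partitionFn_add hBh hWh.neg β
  rw [hBW] at hPB1
  rw [map_neg, Complex.neg_re, hBW'] at hPB2
  -- time reversal: the two twisted blocks have the same partition function
  have hev : (partitionFn β (Hm.toBlock p p)).re = (partitionFn β (Hp.toBlock p p)).re := by
    rw [hHmdef, hHpdef, partitionFn_toBlock_uniformTwist_eq hL U (-θ) β p,
      partitionFn_toBlock_uniformTwist_eq hL U θ β p]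
    exact re_partitionFn_toBlock_hubbardTorusFlux_neg U θ β p
  have hlogB : Real.log (partitionFn β B).re ≤ Real.log (partitionFn β (Hp.toBlock p p)).re := by
    rw [hev] at hPB2
    linarith
  -- monotonicity of the free energy: `B ≤ H1|_p + 2θ²`
  have hmono : Real.log (partitionFn β (H1.toBlock p p + ((2 * θ ^ 2 : ℝ) : ℂ) • 1)).re ≤
      Real.log (partitionFn β B).re := by
    refine log_partitionFn_le_of_posSemidef hBh
      ((hH1.submatrix _).add (isHermitian_ofReal_smul isHermitian_one _)) hβ ?_
    have hfull := (posSemidef_sub_half_twist_add_twist_neg (L := L) θ U).submatrix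
      (Subtype.val : {a // p a} → Finset (Orb (FermionTorus 2 L)))
    convert hfull using 1
    ext a b
    simp only [hB, hH1def, hHpdef, hHmdef, Matrix.sub_apply, Matrix.add_apply, Matrix.smul_apply, submatrix_apply,
      toBlock_apply, one_apply, Subtype.ext_iff, smul_eq_mul]
  -- scalar shift and assembly
  have hshift := log_partitionFn_add_smul_one (hH1.submatrix
    (Subtype.val : {a // p a} → Finset (Orb (FermionTorus 2 L)))) β (2 * θ ^ 2)
  have hfin : Real.log (partitionFn β (H1.toBlock p p)).re - β * (2 * θ ^ 2) ≤
      Real.log (partitionFn β (Hp.toBlock p p)).re := by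
    have h := hmono
    rw [show (H1.toBlock p p + ((2 * θ ^ 2 : ℝ) : ℂ) • 1) =
      H1.submatrix Subtype.val Subtype.val + ((2 * θ ^ 2 : ℝ) : ℂ) • 1 from rfl, hshift] at h
    exact h.trans hlogB
  have hpos1 : 0 < (partitionFn β (H1.toBlock p p)).re := partitionFn_re_pos (hH1.submatrix _) β
  have hposp : 0 < (partitionFn β (Hp.toBlock p p)).re := partitionFn_re_pos (hHp.submatrix _) β
  have hexp := Real.exp_le_exp.mpr hfin
  rw [Real.exp_sub, Real.exp_log hpos1, Real.exp_log hposp, div_le_iff₀ (Real.exp_pos _)] at hexp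
  rw [h1, ← partitionFn_toBlock_uniformTwist_eq hL U θ β p, Real.exp_neg,
    inv_mul_le_iff₀ (Real.exp_pos _)]
  calc (partitionFn β (H1.toBlock p p)).re
      ≤ (partitionFn β (Hp.toBlock p p)).re * Real.exp (β * (2 * θ ^ 2)) := hexp
    _ = Real.exp (2 * β * θ ^ 2) * (partitionFn β (Hp.toBlock p p)).re := by
        rw [mul_comm, show β * (2 * θ ^ 2) = 2 * β * θ ^ 2 by ring]

end Thermal

end Literature.MathematicalPhysics.QuantumLattice

end
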